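import Mathlib
import Summits.AtomisticToContinuum.Crystallization.Theses.ChartedPlanarOrder
import Summits.AtomisticToContinuum.Crystallization.Theorems.ChartedPlanarOrderPalmDoor
import Summits.AtomisticToContinuum.Crystallization.Theorems.PalmUnimodularRigidityCrysPeriodicBddBelow

/-!
# ChartedPlanarOrder — the exact-layer door beneath `CleanLawsChargeLayers` (decomp-a2c lens-3, generation 9)

Tree twin of the cell node «ExactLayerLaws» (run/shared/lean/pub/decomp-a2c/decomp-a2c-lens-3/g9/ExactLayerLaws.lean).
Sorry-free.

* `cleanLawsChargeLayersGlue_proof` — PROVES the split glue item `ChartedPlanarOrder.CleanLawsChargeLayersGlue`: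
  `ZeroExcessLocallyLayered → LocallyLayeredIsLayered → LayeredSpacingWindow → CleanLawsChargeLayers`
  (the three children of stmt-AtomisticToContinuum-33483).  G globalises Z almost surely; inside the spacing window
  `[47/50, 1]` the exact configuration witnesses every `(R, ε)` window event with `t = 0`, `B = 0` and an a.s. event has
  positive probability; outside it, W's periodic competitor and `ciInf_le crysPeriodicBddBelow_proof` contradict
  `E_P[h] ≤ e*`.
* `cleanBallPlanarOrderMaj_of_exactLayers` — `MinimisingLawTransfer → Z → G → W → CleanBallPlanarOrderMaj` through the
  landed palm door `cleanBallPlanarOrderMaj_of_palmDoor`.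
-/

namespace Summit.AtomisticToContinuum.Crystallization.Theorems.ChartedPlanarOrderExactLayerDoor

open MeasureTheory

/-- The support `{p | μ {p} ≠ 0}` of the counting measure of `S` is `S`. [folklore] -/
theorem setOf_count_restrict_singleton_ne_zero (S : Set (EuclideanSpace ℝ (Fin 3))) :
    {p : EuclideanSpace ℝ (Fin 3) |
      ((Measure.count : Measure (EuclideanSpace ℝ (Fin 3))).restrict S) {p} ≠ 0} = S := by
  ext p
  simp only [Set.mem_setOf_eq, Measure.restrict_apply (measurableSet_singleton p), Ne,
    Measure.count_eq_zero_iff, Set.singleton_inter_eq_empty, not_not]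

/-- An almost sure event of a probability law has positive probability. [folklore] -/
theorem measure_pos_of_ae {Ω : Type*} [MeasurableSpace Ω] {P : Measure Ω} [IsProbabilityMeasure P]
    {E : Set Ω} (h : ∀ᵐ ω ∂P, ω ∈ E) : 0 < P E := by
  have hc : P Eᶜ = 0 := by
    rw [ae_iff] at h
    simpa [Set.compl_def] using h
  have h1 : (1 : ENNReal) ≤ P E := by
    calc (1 : ENNReal) = P Set.univ := measure_univ.symm
      _ ≤ P E + P Eᶜ := measure_univ_le_add_compl E
      _ = P E := by rw [hc, add_zero]
  exact lt_of_lt_of_le one_pos h1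

/-- `Z → G → W → L` over the route's decls. [folklore glue; the mathematics is in the three children] -/
theorem cleanLawsChargeLayers_of_exactLayers :
    Theses.ChartedPlanarOrder.ZeroExcessLocallyLayered → Theses.ChartedPlanarOrder.LocallyLayeredIsLayered →
      Theses.ChartedPlanarOrder.LayeredSpacingWindow → Theses.ChartedPlanarOrder.CleanLawsChargeLayers := by
  intro hZ hG hW δ hδ P hP hroot hmecke hen hclean hnash
  obtain ⟨a, ha0, hloc⟩ := hZ δ hδ P hP hroot hmecke hen hclean hnash
  have hglob : ∀ᵐ μ ∂P,
      ∃ (A : EuclideanSpace ℝ (Fin 3) →ₗᵢ[ℝ] EuclideanSpace ℝ (Fin 3)) (s : ℤ → ℤ) (z : ℤ → ℝ),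
        Literature.MathematicalPhysics.StatisticalMechanics.IsHaggSeq s ∧
        (∀ m : ℤ, 39 / 50 * a ≤ z (m + 1) - z m ∧ z (m + 1) - z m ≤ 17 / 20 * a) ∧ z 0 = 0 ∧
        {p : EuclideanSpace ℝ (Fin 3) | μ {p} ≠ 0} = {p | ∃ m i j : ℤ, p = A (((i : ℝ) • Literature.MathematicalPhysics.StatisticalMechanics.triangularVec₁ a) + ((j : ℝ) • Literature.MathematicalPhysics.StatisticalMechanics.triangularVec₂ a) + ((Literature.MathematicalPhysics.StatisticalMechanics.haggLabel s m : ℝ) • Literature.MathematicalPhysics.StatisticalMechanics.barlowOffset a) + (z m • Literature.MathematicalPhysics.StatisticalMechanics.layerNormal 1))} ∧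
        μ = (Measure.count : Measure (EuclideanSpace ℝ (Fin 3))).restrict {p | ∃ m i j : ℤ, p = A (((i : ℝ) • Literature.MathematicalPhysics.StatisticalMechanics.triangularVec₁ a) + ((j : ℝ) • Literature.MathematicalPhysics.StatisticalMechanics.triangularVec₂ a) + ((Literature.MathematicalPhysics.StatisticalMechanics.haggLabel s m : ℝ) • Literature.MathematicalPhysics.StatisticalMechanics.barlowOffset a) + (z m • Literature.MathematicalPhysics.StatisticalMechanics.layerNormal 1))} := by
    filter_upwards [hroot, hloc] with μ hr hl
    obtain ⟨S₀, h0, -, hμ⟩ := hr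
    have hsupp : {p : EuclideanSpace ℝ (Fin 3) | μ {p} ≠ 0} = S₀ := by
      rw [hμ]; exact setOf_count_restrict_singleton_ne_zero S₀
    have h0' : (0 : EuclideanSpace ℝ (Fin 3)) ∈ {p : EuclideanSpace ℝ (Fin 3) | μ {p} ≠ 0} := by
      rw [hsupp]; exact h0
    obtain ⟨A, s, z, hs, hb, hz, hY⟩ := hG a ha0 {p : EuclideanSpace ℝ (Fin 3) | μ {p} ≠ 0} h0'
      (fun q hq => hl q hq)
    refine ⟨A, s, z, hs, hb, hz, hY, ?_⟩
    rw [← hY, hsupp]; exact hμ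
  by_cases hwin : 47 / 50 ≤ a ∧ a ≤ 1
  · refine ⟨a, hwin.1, hwin.2, fun R ε hε => ⟨0, ?_⟩⟩
    apply measure_pos_of_ae
    filter_upwards [hglob] with μ hμ
    obtain ⟨A, s, z, hs, hb, -, hY, -⟩ := hμ
    refine ⟨A, 0, s, z, by simp, hs, hb, ?_⟩
    intro S
    have hSY : S = {p : EuclideanSpace ℝ (Fin 3) | μ {p} ≠ 0} := hY.symm
    refine ⟨fun p hp _ => ⟨p, ?_, by simpa using hε.le⟩, fun q hq _ => ⟨q, ?_, by simpa using hε.le⟩⟩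
    · have : p ∈ {p : EuclideanSpace ℝ (Fin 3) | μ {p} ≠ 0} := hSY ▸ hp
      exact this
    · rw [hSY]; exact hq
  · exfalso
    have hout : a < 47 / 50 ∨ 1 < a := by
      rcases not_and_or.mp hwin with h | h
      · exact Or.inl (not_le.mp h)
      · exact Or.inr (not_le.mp h)
    obtain ⟨Q, hQ⟩ := hW a ha0 hout P hP (by
      filter_upwards [hglob] with μ hμ
      obtain ⟨A, s, z, hs, hb, hz, -, hμ⟩ := hμ
      exact ⟨A, s, z, hs, hb, hz, hμ⟩) hmecke
    have hbdd : BddBelow (Set.range fun Q :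
        Literature.MathematicalPhysics.StatisticalMechanics.PeriodicConfiguration 3 =>
          Q.energyPerParticle Literature.MathematicalPhysics.StatisticalMechanics.lennardJones) :=
      Summit.AtomisticToContinuum.Crystallization.Theorems.crysPeriodicBddBelow_proof
    exact absurd (lt_of_le_of_lt (hen.trans (ciInf_le hbdd Q)) hQ) (lt_irrefl _)

/-- The split glue item `ChartedPlanarOrder.CleanLawsChargeLayersGlue`, by name. [folklore] -/
theorem cleanLawsChargeLayersGlue_proof : Theses.ChartedPlanarOrder.CleanLawsChargeLayersGlue :=
  cleanLawsChargeLayers_of_exactLayers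

/-- Up the registered chain: with the door half `MinimisingLawTransfer` (stmt-33484) the three children prove
`CleanBallPlanarOrderMaj` (stmt-33480) through the landed palm door (p775704). [folklore composition] -/
theorem cleanBallPlanarOrderMaj_of_exactLayers
    (hT : Theses.ChartedPlanarOrder.MinimisingLawTransfer)
    (hZ : Theses.ChartedPlanarOrder.ZeroExcessLocallyLayered) (hG : Theses.ChartedPlanarOrder.LocallyLayeredIsLayered)
    (hW : Theses.ChartedPlanarOrder.LayeredSpacingWindow) :
    Theses.ChartedPlanarOrder.CleanBallPlanarOrderMaj :=
  ChartedPlanarOrderPalmDoor.cleanBallPlanarOrderMaj_of_palmDoor hT (cleanLawsChargeLayers_of_exactLayers hZ hG hW)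

end Summit.AtomisticToContinuum.Crystallization.Theorems.ChartedPlanarOrderExactLayerDoor
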